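import Mathlib
import Summits.ValiantsHypothesis.ValiantsHypothesis.Theorems.NewtonUnitEquationsDissociatedUniformTotalsLaw
import Summits.ValiantsHypothesis.ValiantsHypothesis.Theorems.NewtonUnitEquationsDissociatedUniformTotalsLawUnimodal
import Summits.ValiantsHypothesis.ValiantsHypothesis.Theorems.NewtonUnitEquationsDissociatedUniformTotalsLawUnimodalGraphs
import Summits.ValiantsHypothesis.ValiantsHypothesis.Theorems.NewtonUnitEquationsDissociatedUniformTotalsLawHexagon
import Summits.ValiantsHypothesis.ValiantsHypothesis.Theorems.NewtonUnitEquationsDissociatedUniformTotalsLawHodograph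
import Summits.ValiantsHypothesis.ValiantsHypothesis.Theorems.NewtonUnitEquationsDissociatedUniformTotalsLawHodographFamilies
import Summits.ValiantsHypothesis.ValiantsHypothesis.Theorems.NewtonUnitEquationsDissociatedUniformTotalsLawHodographRelabel
import Summits.ValiantsHypothesis.ValiantsHypothesis.Theorems.NewtonUnitEquationsDissociatedUniformTotalsLawMultipliers
import Summits.ValiantsHypothesis.ValiantsHypothesis.Theorems.NewtonUnitEquationsDissociatedUniformTotalsLawCosine
import HarnessLib

/-!
# Crux `NewtonUnitEquations.DissociatedUniform` (stmt-ValiantsHypothesis-5905), `n = 3` totals law of model (Q**):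
# CIRCLES and REGULAR POLYGONS (with multipliers) BY NAME — `T ≤ 6q² + 6Z`, resp. `≤ 2(m_a+m_b+m_c)q² + 6Z`

The extremal census families of NOTES-d1g3 §3 (both regimes attain `T = 2.00 q²`) are regular polygons / sampled circles
`trigCurve c₀ A φ : k ↦ c₀ + A·(cos(φ + 2πk/q), sin(φ + 2πk/q))` of arbitrary centre, radius (any real `A`) and phase, possibly read
with a multiplier ("circle(m)").  Here:
* `convexlyOrdered_trigCurve`: every such curve is convexly ordered (`⟨w, ·⟩ = const + A‖w‖ cos(θ − arg w)`, polar form via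
  `Complex.norm_mul_cos_arg`, and `…TotalsLawCosine.cycUnimodal_mul_cos`);
* `chordVec_trigCurve`: its `m`-step chord curve is again a `trigCurve` (radius `2A sin(πm/q)`, phase `+ πm/q + π/2`; the sum-to-product
  formulas), in particular its hodograph (`m = 1`); hence `convexlyOrdered_chordVec_trigCurve`, `convexlyOrdered_edgeVec_trigCurve`;
* **`totalVert_trigCurves_le`**: for ANY three such curves `T ≤ 6q² + 6Z` (`…HodographFamilies.totalVert_le_six_mul_sq_add`);
* **`totalVert_trigCurves_multiplier_le`**: read with unit multipliers `u_a, u_b, u_c`, `T ≤ 2(m_a+m_b+m_c)·q² + 6Z`,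
  `m_i = min(u_i.val, q − u_i.val)` (`…Multipliers.totalVert_le_of_multipliers`).
`Z` is the collinear edge-vector count of the three curves (`0` in general position).  `TotalsLawThree C` for arbitrary labellings remains
OPEN; VP ≠ VNP is not touched.
[folklore: sum-to-product formulas; the chords of a regular polygon with a fixed step form a regular polygon]
-/

set_option linter.dupNamespace false -- `ValiantsHypothesis.ValiantsHypothesis` (summit = problem) in every name

open scoped BigOperators Pointwise

namespace Summit.ValiantsHypothesis.ValiantsHypothesis.Theorems.NewtonUnitEquationsDissociatedUniform

namespace TotalsLaw

open Real Matrix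

section Circles

variable {q : ℕ} [NeZero q]

/-- The sampled circle / regular polygon `k ↦ c₀ + A (cos(φ + 2πk/q), sin(φ + 2πk/q))` (any real "radius" `A`). -/
noncomputable def trigCurve (c₀ : Fin 2 → ℝ) (A φ : ℝ) (k : ZMod q) : Fin 2 → ℝ :=
  c₀ + ![A * Real.cos (φ + 2 * π * (k.val : ℝ) / q), A * Real.sin (φ + 2 * π * (k.val : ℝ) / q)]

omit [NeZero q] in
/-- Adding a constant keeps cyclic unimodality. [folklore] -/
theorem CycUnimodal.add_const' {f : ZMod q → ℝ} (hf : CycUnimodal f) (c : ℝ) : CycUnimodal fun k => f k + c := by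
  obtain ⟨n, d, h⟩ := hf
  exact ⟨n, d, h.add_const c⟩

omit [NeZero q] in
/-- A linear functional along a `trigCurve` is a sampled cosine plus a constant (polar form of the weight). [folklore] -/
theorem dotProduct_trigCurve (w c₀ : Fin 2 → ℝ) (A φ : ℝ) (k : ZMod q) :
    w ⬝ᵥ trigCurve c₀ A φ k =
      A * ‖(⟨w 0, w 1⟩ : ℂ)‖ * Real.cos ((φ - Complex.arg ⟨w 0, w 1⟩) + 2 * π * (k.val : ℝ) / q) + w ⬝ᵥ c₀ := by
  set z : ℂ := ⟨w 0, w 1⟩ with hz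
  have h0 : w 0 = ‖z‖ * Real.cos (Complex.arg z) := by rw [Complex.norm_mul_cos_arg]
  have h1 : w 1 = ‖z‖ * Real.sin (Complex.arg z) := by rw [Complex.norm_mul_sin_arg]
  unfold trigCurve
  simp only [dotProduct_add, dotProduct_fin_two, Matrix.cons_val_zero, Matrix.cons_val_one]
  rw [show φ - Complex.arg z + 2 * π * (k.val : ℝ) / q = (φ + 2 * π * (k.val : ℝ) / q) - Complex.arg z by ring, Real.cos_sub]
  rw [h0, h1]; ring

/-- **Sampled circles / regular polygons are convexly ordered** (any centre, real radius, phase). [folklore] -/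
theorem convexlyOrdered_trigCurve (c₀ : Fin 2 → ℝ) (A φ : ℝ) : ConvexlyOrdered (trigCurve (q := q) c₀ A φ) := by
  intro w
  have h := (cycUnimodal_mul_cos (q := q) (A * ‖(⟨w 0, w 1⟩ : ℂ)‖) (φ - Complex.arg ⟨w 0, w 1⟩)).add_const' (w ⬝ᵥ c₀)
  convert h using 2 with k
  rw [dotProduct_trigCurve]

omit [NeZero q] in
/-- Chord identity, cosine coordinate: `A cos(θ + δ) − A cos θ = 2A sin(δ/2) · cos(θ + δ/2 + π/2)`. [folklore] -/
theorem chord_cos (A θ δ : ℝ) :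
    A * Real.cos (θ + δ) - A * Real.cos θ = 2 * A * Real.sin (δ / 2) * Real.cos (θ + δ / 2 + π / 2) := by
  rw [Real.cos_add_pi_div_two]
  have h := Real.cos_sub_cos (θ + δ) θ
  rw [show (θ + δ + θ) / 2 = θ + δ / 2 by ring, show (θ + δ - θ) / 2 = δ / 2 by ring] at h
  linear_combination A * h

omit [NeZero q] in
/-- Chord identity, sine coordinate: `A sin(θ + δ) − A sin θ = 2A sin(δ/2) · sin(θ + δ/2 + π/2)`. [folklore] -/
theorem chord_sin (A θ δ : ℝ) :
    A * Real.sin (θ + δ) - A * Real.sin θ = 2 * A * Real.sin (δ / 2) * Real.sin (θ + δ / 2 + π / 2) := by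
  rw [Real.sin_add_pi_div_two]
  have h := Real.sin_sub_sin (θ + δ) θ
  rw [show (θ + δ - θ) / 2 = δ / 2 by ring, show (θ + δ + θ) / 2 = θ + δ / 2 by ring] at h
  linear_combination A * h

/-- `sin(α + 2πv/q)` only depends on `v mod q`. [folklore] -/
theorem sin_phase_mod (α : ℝ) (v : ℕ) :
    Real.sin (α + 2 * π * (((v % q : ℕ)) : ℝ) / q) = Real.sin (α + 2 * π * (v : ℝ) / q) := by
  have hqpos : (0 : ℝ) < q := by exact_mod_cast Nat.pos_of_ne_zero (NeZero.ne q)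
  have hv : (v : ℝ) = ((v % q : ℕ) : ℝ) + (q : ℝ) * ((v / q : ℕ) : ℝ) := by exact_mod_cast (Nat.mod_add_div v q).symm
  rw [hv]
  have e : α + 2 * π * (((v % q : ℕ) : ℝ) + (q : ℝ) * ((v / q : ℕ) : ℝ)) / q =
      α + 2 * π * ((v % q : ℕ) : ℝ) / q + ((v / q : ℕ) : ℝ) * (2 * π) := by
    field_simp; ring
  rw [e, Real.sin_add_nat_mul_two_pi]

/-- **The chord curve of a sampled circle is a sampled circle**: step `m` gives radius `2A sin(πm/q)` and phase `φ + πm/q + π/2`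
(centre `0`). [folklore] -/
theorem chordVec_trigCurve (c₀ : Fin 2 → ℝ) (A φ : ℝ) (m : ℕ) (k : ZMod q) :
    chordVec (trigCurve c₀ A φ) (m : ZMod q) k =
      trigCurve 0 (2 * A * Real.sin (π * m / q)) (φ + π * m / q + π / 2) k := by
  have hqpos : (0 : ℝ) < q := by exact_mod_cast Nat.pos_of_ne_zero (NeZero.ne q)
  have hval : (k + (m : ZMod q)).val = (k.val + m) % q := by
    rw [show k + (m : ZMod q) = ((k.val + m : ℕ) : ZMod q) by push_cast; rw [ZMod.natCast_zmod_val], ZMod.val_natCast]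
  unfold chordVec trigCurve
  rw [hval, add_sub_add_left_eq_sub, zero_add]
  have ec : Real.cos (φ + 2 * π * (((k.val + m) % q : ℕ) : ℝ) / q) = Real.cos ((φ + 2 * π * (k.val : ℝ) / q) + 2 * π * m / q) := by
    rw [cos_phase_mod]; push_cast; ring_nf
  have es : Real.sin (φ + 2 * π * (((k.val + m) % q : ℕ) : ℝ) / q) = Real.sin ((φ + 2 * π * (k.val : ℝ) / q) + 2 * π * m / q) := by
    rw [sin_phase_mod]; push_cast; ring_nf
  ext i
  fin_cases i
  · simp only [Fin.zero_eta, Fin.isValue, Pi.sub_apply, Matrix.cons_val_zero]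
    rw [ec, chord_cos]
    congr 1 <;> ring_nf
  · simp only [Fin.mk_one, Fin.isValue, Pi.sub_apply, Matrix.cons_val_one, Matrix.cons_val_zero]
    rw [es, chord_sin]
    congr 1 <;> ring_nf

/-- The chord curves of a sampled circle are convexly ordered. [folklore] -/
theorem convexlyOrdered_chordVec_trigCurve (c₀ : Fin 2 → ℝ) (A φ : ℝ) (m : ℕ) :
    ConvexlyOrdered (chordVec (trigCurve (q := q) c₀ A φ) (m : ZMod q)) := by
  have e : chordVec (trigCurve (q := q) c₀ A φ) (m : ZMod q) =
      trigCurve 0 (2 * A * Real.sin (π * m / q)) (φ + π * m / q + π / 2) := funext fun k => chordVec_trigCurve c₀ A φ m k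
  rw [e]; exact convexlyOrdered_trigCurve _ _ _

/-- … for a unit step. [folklore] -/
theorem convexlyOrdered_chordVec_trigCurve_unit (c₀ : Fin 2 → ℝ) (A φ : ℝ) (u : (ZMod q)ˣ) :
    ConvexlyOrdered (chordVec (trigCurve (q := q) c₀ A φ) (u : ZMod q)) := by
  have h := convexlyOrdered_chordVec_trigCurve (q := q) c₀ A φ (u : ZMod q).val
  have e : (((u : ZMod q).val : ℕ) : ZMod q) = (u : ZMod q) := ZMod.natCast_zmod_val _
  rw [e] at h
  exact h

/-- The hodograph of a sampled circle is convexly ordered. [folklore] -/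
theorem convexlyOrdered_edgeVec_trigCurve (c₀ : Fin 2 → ℝ) (A φ : ℝ) : ConvexlyOrdered (edgeVec (trigCurve (q := q) c₀ A φ)) := by
  have e : edgeVec (trigCurve (q := q) c₀ A φ) = chordVec (trigCurve (q := q) c₀ A φ) ((1 : ℕ) : ZMod q) := by
    funext k; simp [edgeVec, chordVec]
  rw [e]; exact convexlyOrdered_chordVec_trigCurve _ _ _ 1

/-- **The `n = 3` totals law for three sampled circles / regular polygons** (any centres, radii, phases; natural labels):
`T ≤ 6q² + 6Z`.  Covers the census extremisers of both regimes ("A huge, c tiny", "c huge convex", circles of comparable radii).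
[folklore] -/
theorem totalVert_trigCurves_le (c₁ : Fin 2 → ℝ) (A₁ φ₁ : ℝ) (c₂ : Fin 2 → ℝ) (A₂ φ₂ : ℝ) (c₃ : Fin 2 → ℝ) (A₃ φ₃ : ℝ) :
    totalVert (trigCurve (q := q) c₁ A₁ φ₁) (trigCurve c₂ A₂ φ₂) (trigCurve c₃ A₃ φ₃) ≤
      6 * q ^ 2 + 6 * zeroCount (trigCurve (q := q) c₁ A₁ φ₁) (trigCurve c₂ A₂ φ₂) (trigCurve c₃ A₃ φ₃) :=
  totalVert_le_six_mul_sq_add _ _ _ (convexlyOrdered_edgeVec_trigCurve c₁ A₁ φ₁) (convexlyOrdered_edgeVec_trigCurve c₂ A₂ φ₂)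
    (convexlyOrdered_edgeVec_trigCurve c₃ A₃ φ₃)

/-- **… read with multipliers** ("circle(m)" families): `T ≤ 2(m_a + m_b + m_c)·q² + 6Z`, `m_i = min(u_i.val, q − u_i.val)`. [folklore] -/
theorem totalVert_trigCurves_multiplier_le (c₁ : Fin 2 → ℝ) (A₁ φ₁ : ℝ) (c₂ : Fin 2 → ℝ) (A₂ φ₂ : ℝ) (c₃ : Fin 2 → ℝ) (A₃ φ₃ : ℝ)
    (ua ub uc : (ZMod q)ˣ) :
    totalVert (fun k => trigCurve (q := q) c₁ A₁ φ₁ ((ua : ZMod q) * k)) (fun k => trigCurve c₂ A₂ φ₂ ((ub : ZMod q) * k))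
        (fun k => trigCurve c₃ A₃ φ₃ ((uc : ZMod q) * k)) ≤
      (2 * min (ua : ZMod q).val (q - (ua : ZMod q).val) + 2 * min (ub : ZMod q).val (q - (ub : ZMod q).val) +
          2 * min (uc : ZMod q).val (q - (uc : ZMod q).val)) * q ^ 2 +
        6 * zeroCount (fun k => trigCurve (q := q) c₁ A₁ φ₁ ((ua : ZMod q) * k)) (fun k => trigCurve c₂ A₂ φ₂ ((ub : ZMod q) * k))
          (fun k => trigCurve c₃ A₃ φ₃ ((uc : ZMod q) * k)) :=
  totalVert_le_of_multipliers _ _ _ ua ub uc (convexlyOrdered_chordVec_trigCurve_unit c₁ A₁ φ₁ ua)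
    (convexlyOrdered_chordVec_trigCurve_unit c₂ A₂ φ₂ ub) (convexlyOrdered_chordVec_trigCurve_unit c₃ A₃ φ₃ uc)

end Circles

end TotalsLaw

end Summit.ValiantsHypothesis.ValiantsHypothesis.Theorems.NewtonUnitEquationsDissociatedUniform
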